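import Summits.CriticalPhenomena.SAWScalingLimit.Theses.SAWExpCovariance

/-!
# Route SAWExpCovariance — support item `RotationsFromExp` (stmt-CriticalPhenomena-6759)

We prove `Summit.CriticalPhenomena.SAWScalingLimit.Theses.SAWExpCovariance.RotationsFromExp`:
a chordal family `P` on Dobrushin domains which
* sees a Dobrushin domain only through `(carrier, a, b)` (hypothesis `hCD`),
* is covariant under `z ↦ r z + w`, `r > 0`, `w ∈ ℂ` (hypothesis `hSim`), and
* is covariant under `exp` on every Dobrushin domain `U` with `exp` injective on `closure U`
  (hypothesis `hExp`),
is covariant under every orientation-preserving similarity `z ↦ c z + w`, `c ≠ 0`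
(`ChordalFamily.IsSimilarityCovariant`). Chordality of `P` is not used.

Proof ("rotations are vertical translations of log-coordinates", Cardy's logarithmic map):
1. `rotation_of_closure_subset`: for a Dobrushin domain `D` with `closure D ⊆ {Re z > 0}` the
   log-image `U = Log D` is a Dobrushin domain (`exists_dobrushinDomain_image`: the image of a
   Jordan / marked domain under an open partial homeomorphism of the plane defined near its
   closure, here `Complex.expOpenPartialHomeomorph.symm`); `closure U` lies in the strip
   `|Im z| < π / 2`, so `exp` is injective on `closure U` and on `closure (U + iα)`. Then
   `P D = exp_* P U` (hExp), `P (U + iα) = (T_{iα})_* P U` (hSim with `r = 1`) and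
   `P (e^{iα} D) = exp_* P (U + iα)` (hExp), whence `P (e^{iα} D) = (R_α)_* P D` because
   `exp ∘ T_{iα} = R_α ∘ exp`.
2. `rotation_covariance`: a general `D` is first translated into the right half-plane (hSim with
   `r = 1`, hCD to identify Dobrushin domains with the same carrier and marked points).
3. `rotationsFromExp_proof`: `c z + w = ‖c‖ (e^{i arg c} z) + w` (hSim with `r = ‖c‖`, hCD,
   functoriality of push-forward).

Measurability of `CurveClass.map exp` (needed for `Measure.map_map`) is proved here from first
principles by the Heine–Cantor argument (`measurable_curveClassMap_exp`); the tree's general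
`CurveClass.measurable_map` lives in `ConformalRestrictionProofs.lean`, on the
LSW03 / CritPercSLE module chain which the route file keeps out of its module cone on purpose
(cone repair 2026-08-15), so that module is not imported here. The only import is the route
file itself.

References: V. Beffara, *Is critical 2D percolation universal?*, Progr. Probab. 60 (2008), §2;
J. Cardy, *Conformal invariance and surface critical behavior*, Nucl. Phys. B 240 (1984)
(the logarithmic map strip ↔ wedge); W. Werner, *Lectures on two-dimensional critical
percolation* (2007), §3.2 (1).
-/

noncomputable section

open Set MeasureTheory Filter Topology
open Literature.Probability.RandomPlanarGeometry

namespace Summit.CriticalPhenomena.SAWScalingLimit.Theorems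

/-! ### Push-forward of curve classes along `exp`; functoriality -/

/-- The push-forward of planar curve classes along `exp` is Borel measurable (so that image laws
along `exp` compose, `Measure.map_map`). It is continuous: `γ ↦ exp ∘ γ` is continuous for the
reparametrisation distance by Heine–Cantor at the compact trace of a curve (Aizenman–Burchard
1999 §2.1), and continuity descends to the metric quotient. (The tree proves this for every
continuous map as `CurveClass.measurable_map` in `ConformalRestrictionProofs.lean`; that module
sits on the LSW03 / CritPercSLE chain kept out of this route's cone, so only the `exp` instance
needed here is proved, from first principles.) [folklore] -/
theorem measurable_curveClassMap_exp :
    Measurable (CurveClass.map (⟨Complex.exp, Complex.continuous_exp⟩ : C(ℂ, ℂ))) := by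
  set f : C(ℂ, ℂ) := ⟨Complex.exp, Complex.continuous_exp⟩
  have hcont : Continuous (Curve.map f) := by
    rw [Metric.continuous_iff]
    intro γ₁ ε hε
    have hK := γ₁.isCompact_range.uniformContinuousAt_of_continuousAt f
      (fun a _ ↦ f.continuous.continuousAt) (Metric.dist_mem_uniformity (half_pos hε))
    obtain ⟨δ, hδ, hδε⟩ := Metric.mem_uniformity_dist.1 hK
    refine ⟨δ, hδ, fun γ₂ hγ ↦ ?_⟩
    rw [dist_comm] at hγ ⊢
    obtain ⟨φ, hφ⟩ := Curve.exists_dist_reparam_lt hγ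
    refine lt_of_le_of_lt ?_ (half_lt_self hε)
    refine (Curve.reparamDist_le _ _ φ).trans
      ((ContinuousMap.dist_le (half_pos hε).le).2 fun t ↦ ?_)
    rw [← Curve.map_reparam]
    refine le_of_lt (hδε ?_ ⟨t, rfl⟩)
    exact (ContinuousMap.dist_apply_le_dist (f := γ₁.toContinuousMap)
      (g := (γ₂.reparam φ).toContinuousMap) t).trans_lt hφ
  have h : Continuous (CurveClass.map f) := by
    unfold CurveClass.map
    exact SeparationQuotient.continuous_lift_iff.2 (CurveClass.continuous_mk.comp hcont)
  exact h.measurable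

/-- Functoriality of the push-forward of curve classes: `(c.map f).map g = c.map (g ∘ f)`.
[folklore] -/
theorem curveClass_map_map' {E F G : Type*} [PseudoMetricSpace E] [PseudoMetricSpace F]
    [PseudoMetricSpace G] (f : C(E, F)) (g : C(F, G)) (c : CurveClass E) :
    (c.map f).map g = c.map (g.comp f) := by
  obtain ⟨γ, rfl⟩ := CurveClass.surjective_mk c
  rfl

/-! ### Image of a Dobrushin domain under a partial homeomorphism defined near its closure -/

/-- For an open partial homeomorphism `e` of the plane defined on a neighbourhood of the compact
set `closure D`, `e '' closure D = closure (e '' D)`. [folklore] -/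
theorem image_closure_eq_of_closure_subset_source (D : JordanDomain)
    (e : OpenPartialHomeomorph ℂ ℂ) (h : closure D.carrier ⊆ e.source) :
    e '' closure D.carrier = closure (e '' D.carrier) := by
  refine Subset.antisymm (e.continuousOn.mono h).image_closure ?_
  exact closure_minimal (image_mono subset_closure)
    (D.isBounded.isCompact_closure.image_of_continuousOn (e.continuousOn.mono h)).isClosed

/-- For an open partial homeomorphism `e` of the plane defined on a neighbourhood of
`closure D`, `D` a bounded open set, `e '' ∂D = ∂(e '' D)`. [folklore] -/
theorem image_frontier_eq_of_closure_subset_source (D : JordanDomain)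
    (e : OpenPartialHomeomorph ℂ ℂ) (h : closure D.carrier ⊆ e.source) :
    e '' frontier D.carrier = frontier (e '' D.carrier) := by
  have hopen : IsOpen (e '' D.carrier) :=
    e.isOpen_image_of_subset_source D.isOpen (subset_closure.trans h)
  rw [D.isOpen.frontier_eq, hopen.frontier_eq, ← image_closure_eq_of_closure_subset_source D e h,
    (e.injOn.mono h).image_sdiff_subset subset_closure]

/-- **Image Dobrushin domain.** If `e` is an open partial homeomorphism of the plane whose source
contains `closure D`, then `(e '' D; e a, e b)` is again a Dobrushin domain, with boundary loop
`e ∘ ∂D` and the same boundary parameters (genuine construction, all fields proved; stated as an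
existence so that no new definition is introduced). [folklore] -/
theorem exists_dobrushinDomain_image (D : DobrushinDomain) (e : OpenPartialHomeomorph ℂ ℂ)
    (h : closure D.carrier ⊆ e.source) :
    ∃ U : DobrushinDomain, U.carrier = e '' D.carrier ∧
      closure U.carrier = e '' closure D.carrier ∧ U.pt 0 = e (D.pt 0) ∧ U.pt 1 = e (D.pt 1) := by
  have hbd : ∀ t, D.boundary t ∈ e.source := fun t =>
    h (frontier_subset_closure (D.boundary_mem_frontier t))
  refine ⟨{ carrier := e '' D.carrier
            boundary := e ∘ D.boundary
            isOpen := e.isOpen_image_of_subset_source D.isOpen (subset_closure.trans h)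
            isBounded := (D.isBounded.isCompact_closure.image_of_continuousOn
              (e.continuousOn.mono h)).isBounded.subset (image_mono subset_closure)
            isConnected := D.isConnected.image _ (e.continuousOn.mono (subset_closure.trans h))
            continuous_boundary := e.continuousOn.comp_continuous D.continuous_boundary hbd
            periodic_boundary := D.periodic_boundary.comp e
            injOn_boundary := e.injOn.comp D.injOn_boundary fun t _ => hbd t
            range_boundary := by
              rw [range_comp, D.range_boundary,
                image_frontier_eq_of_closure_subset_source _ e h]
            mark := D.mark
            strictMono_mark := D.strictMono_mark
            mark_mem := D.mark_mem }, rfl, ?_, rfl, rfl⟩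
  exact (image_closure_eq_of_closure_subset_source D.toJordanDomain e h).symm

/-- **The log-image of a Dobrushin domain in the right half-plane.** If `closure D ⊆ {Re z > 0}`
then there is a Dobrushin domain `U = Log D` (principal logarithm) with `closure U = Log (closure
D)` and marked points `Log a`, `Log b`. [folklore] -/
theorem exists_dobrushinDomain_log (D : DobrushinDomain)
    (hD : closure D.carrier ⊆ {z : ℂ | 0 < z.re}) :
    ∃ U : DobrushinDomain, U.carrier = Complex.log '' D.carrier ∧
      closure U.carrier = Complex.log '' closure D.carrier ∧
        U.pt 0 = Complex.log (D.pt 0) ∧ U.pt 1 = Complex.log (D.pt 1) := by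
  have h : closure D.carrier ⊆ Complex.expOpenPartialHomeomorph.symm.source := fun z hz => by
    rw [OpenPartialHomeomorph.symm_source]
    exact Complex.mem_slitPlane_iff.2 (Or.inl (hD hz))
  exact exists_dobrushinDomain_image D Complex.expOpenPartialHomeomorph.symm h

/-! ### Injectivity of `exp` on thin horizontal strips -/

/-- `exp` is injective on any set whose imaginary parts stay within `π` of a fixed level `a`
(two preimages of a point under `exp` differ by a non-zero multiple of `2πi`). [folklore] -/
theorem injOn_exp_of_abs_im_sub_level_lt {S : Set ℂ} (a : ℝ) (hS : ∀ z ∈ S, |z.im - a| < Real.pi) :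
    InjOn Complex.exp S := by
  intro x hx y hy hxy
  obtain ⟨n, hn⟩ := Complex.exp_eq_exp_iff_exists_int.1 hxy
  have him : x.im = y.im + n * (2 * Real.pi) := by
    have := congrArg Complex.im hn
    simpa using this
  have h1 : |x.im - y.im| < 2 * Real.pi := by
    calc |x.im - y.im| = |(x.im - a) - (y.im - a)| := by ring_nf
      _ ≤ |x.im - a| + |y.im - a| := abs_sub _ _
      _ < Real.pi + Real.pi := add_lt_add (hS x hx) (hS y hy)
      _ = 2 * Real.pi := by ring
  rw [him, add_sub_cancel_left, abs_mul, abs_of_pos Real.two_pi_pos,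
    mul_lt_iff_lt_one_left Real.two_pi_pos] at h1
  have hn0 : n = 0 := by
    have h2 : |n| < (1 : ℤ) := by exact_mod_cast h1
    exact Int.abs_lt_one_iff.1 h2
  subst hn0
  simpa using hn

/-! ### Step 1: rotations about `0` of domains in the right half-plane -/

/-- **Rotations are vertical translations of log-coordinates.** For a Dobrushin domain `D` with
`closure D ⊆ {Re z > 0}` and a family `P` covariant under translations/dilations and under `exp`
(on exp-injective closures), `P (e^{iα} D) = (z ↦ e^{iα} z)_* P D`: with `U = Log D`,
`P D = exp_* P U`, `P (U + iα) = (T_{iα})_* P U`, `P (e^{iα} D) = exp_* P (U + iα)` and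
`exp ∘ T_{iα} = R_α ∘ exp`. [folklore] -/
theorem rotation_of_closure_subset (P : ChordalFamily)
    (hSim : ∀ (D : DobrushinDomain) (r : ℝ) (hr : 0 < r) (w : ℂ),
      P (D.map (similarity (r : ℂ) (Complex.ofReal_ne_zero.mpr hr.ne') w)) =
        (P D).map (CurveClass.map
          (similarity (r : ℂ) (Complex.ofReal_ne_zero.mpr hr.ne') w : C(ℂ, ℂ))))
    (hExp : ∀ (U V : DobrushinDomain), Set.InjOn Complex.exp (closure U.carrier) →
      V.carrier = Complex.exp '' U.carrier → V.pt 0 = Complex.exp (U.pt 0) →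
        V.pt 1 = Complex.exp (U.pt 1) →
          P V = (P U).map (CurveClass.map (⟨Complex.exp, Complex.continuous_exp⟩ : C(ℂ, ℂ))))
    (D : DobrushinDomain) (hD : closure D.carrier ⊆ {z : ℂ | 0 < z.re}) (α : ℝ) :
    P (D.map (similarity (Complex.exp (α * Complex.I)) (Complex.exp_ne_zero _) 0)) =
      (P D).map (CurveClass.map
        (similarity (Complex.exp (α * Complex.I)) (Complex.exp_ne_zero _) 0 : C(ℂ, ℂ))) := by
  obtain ⟨U, hUc, hUcl, hU0, hU1⟩ := exists_dobrushinDomain_log D hD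
  -- points of `closure D` are non-zero, so `exp ∘ log = id` there
  have hexplog : ∀ d ∈ closure D.carrier, Complex.exp (Complex.log d) = d := fun d hd => by
    refine Complex.exp_log fun h0 => ?_
    have := hD hd
    simp [h0] at this
  -- `closure U` lies in the strip `|Im| < π / 2`
  have hUim : ∀ z ∈ closure U.carrier, |z.im| < Real.pi / 2 := by
    intro z hz
    rw [hUcl] at hz
    obtain ⟨d, hd, rfl⟩ := hz
    rw [Complex.log_im, Complex.abs_arg_lt_pi_div_two_iff]
    exact Or.inl (hD hd)
  -- Step (a): `P D = exp_* P U`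
  have h1 : P D = (P U).map (CurveClass.map (⟨Complex.exp, Complex.continuous_exp⟩ : C(ℂ, ℂ))) := by
    refine hExp U D (injOn_exp_of_abs_im_sub_level_lt 0 fun z hz => ?_) ?_ ?_ ?_
    · rw [sub_zero]
      linarith [hUim z hz, Real.pi_pos]
    · rw [hUc, image_image]
      exact (EqOn.image_eq_self (f := fun d => Complex.exp (Complex.log d))
        fun d hd => hexplog d (subset_closure hd)).symm
    · rw [hU0, hexplog _ (frontier_subset_closure (D.pt_mem_frontier 0))]
    · rw [hU1, hexplog _ (frontier_subset_closure (D.pt_mem_frontier 1))]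
  -- the vertical translation `T z = z + iα` and the rotation `R z = e^{iα} z`
  have one_pos' : (0 : ℝ) < 1 := one_pos
  set T : ℂ ≃ₜ ℂ := similarity ((1 : ℝ) : ℂ) (Complex.ofReal_ne_zero.mpr one_pos'.ne')
    ((α : ℂ) * Complex.I) with hT
  have hTap : ∀ z, T z = z + α * Complex.I := fun z => by
    rw [hT, similarity_apply]; push_cast; ring
  set R : ℂ ≃ₜ ℂ := similarity (Complex.exp (α * Complex.I)) (Complex.exp_ne_zero _) 0 with hR
  have hRap : ∀ z, R z = Complex.exp (α * Complex.I) * z := fun z => by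
    rw [hR, similarity_apply, add_zero]
  have hkey : ∀ z, Complex.exp (T z) = R (Complex.exp z) := fun z => by
    rw [hTap, hRap, Complex.exp_add, mul_comm]
  -- Step (b): `P (U + iα) = T_* P U`
  have h2 : P (U.map T) = (P U).map (CurveClass.map (T : C(ℂ, ℂ))) := hSim U 1 one_pos' _
  -- Step (c): `P (R D) = exp_* P (U + iα)`
  have h3 : P (D.map R) =
      (P (U.map T)).map (CurveClass.map (⟨Complex.exp, Complex.continuous_exp⟩ : C(ℂ, ℂ))) := by
    refine hExp (U.map T) (D.map R) (injOn_exp_of_abs_im_sub_level_lt α fun z hz => ?_) ?_ ?_ ?_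
    · rw [MarkedDomain.carrier_map, ← T.image_closure] at hz
      obtain ⟨u, hu, rfl⟩ := hz
      have h' : |u.im| < Real.pi := (hUim u hu).trans (half_lt_self Real.pi_pos)
      rw [hTap]
      simpa using h'
    · rw [MarkedDomain.carrier_map, MarkedDomain.carrier_map, hUc, image_image, image_image]
      refine image_congr fun d hd => ?_
      rw [hkey, hexplog d (subset_closure hd)]
    · rw [MarkedDomain.pt_map, MarkedDomain.pt_map, hU0, hkey,
        hexplog _ (frontier_subset_closure (D.pt_mem_frontier 0))]
    · rw [MarkedDomain.pt_map, MarkedDomain.pt_map, hU1, hkey,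
        hexplog _ (frontier_subset_closure (D.pt_mem_frontier 1))]
  -- combine
  rw [h3, h2, h1,
    Measure.map_map measurable_curveClassMap_exp (measurable_curveClassMap_similarity _ _ _),
    Measure.map_map (measurable_curveClassMap_similarity _ _ _) measurable_curveClassMap_exp]
  congr 1
  funext c
  simp only [Function.comp_apply, curveClass_map_map']
  congr 1
  ext1 z
  simp only [ContinuousMap.comp_apply, ContinuousMap.coe_mk]
  exact hkey z

/-! ### Step 2: rotations about `0` of all Dobrushin domains -/

/-- **Rotation covariance about the origin** for every Dobrushin domain: translate `D` into the
right half-plane by a real `t` (hSim with `r = 1`), rotate there (`rotation_of_closure_subset`),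
translate back by `-e^{iα} t`, and identify the resulting domain with `e^{iα} D` through its
carrier and marked points (hCD). [folklore] -/
theorem rotation_covariance (P : ChordalFamily)
    (hCD : ∀ (D D' : DobrushinDomain), D.carrier = D'.carrier → D.pt 0 = D'.pt 0 →
      D.pt 1 = D'.pt 1 → P D = P D')
    (hSim : ∀ (D : DobrushinDomain) (r : ℝ) (hr : 0 < r) (w : ℂ),
      P (D.map (similarity (r : ℂ) (Complex.ofReal_ne_zero.mpr hr.ne') w)) =
        (P D).map (CurveClass.map
          (similarity (r : ℂ) (Complex.ofReal_ne_zero.mpr hr.ne') w : C(ℂ, ℂ))))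
    (hExp : ∀ (U V : DobrushinDomain), Set.InjOn Complex.exp (closure U.carrier) →
      V.carrier = Complex.exp '' U.carrier → V.pt 0 = Complex.exp (U.pt 0) →
        V.pt 1 = Complex.exp (U.pt 1) →
          P V = (P U).map (CurveClass.map (⟨Complex.exp, Complex.continuous_exp⟩ : C(ℂ, ℂ))))
    (D : DobrushinDomain) (α : ℝ) :
    P (D.map (similarity (Complex.exp (α * Complex.I)) (Complex.exp_ne_zero _) 0)) =
      (P D).map (CurveClass.map
        (similarity (Complex.exp (α * Complex.I)) (Complex.exp_ne_zero _) 0 : C(ℂ, ℂ))) := by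
  obtain ⟨M, hM⟩ : ∃ M, ∀ z ∈ closure D.carrier, ‖z‖ ≤ M :=
    isBounded_iff_forall_norm_le.1 D.isBounded.closure
  have one_pos' : (0 : ℝ) < 1 := one_pos
  -- translation into the right half-plane
  set T : ℂ ≃ₜ ℂ := similarity ((1 : ℝ) : ℂ) (Complex.ofReal_ne_zero.mpr one_pos'.ne')
    ((M + 1 : ℝ) : ℂ) with hT
  have hTap : ∀ z, T z = z + ((M + 1 : ℝ) : ℂ) := fun z => by
    rw [hT, similarity_apply]; push_cast; ring
  set R : ℂ ≃ₜ ℂ := similarity (Complex.exp (α * Complex.I)) (Complex.exp_ne_zero _) 0 with hR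
  have hRap : ∀ z, R z = Complex.exp (α * Complex.I) * z := fun z => by
    rw [hR, similarity_apply, add_zero]
  -- translation back
  set T' : ℂ ≃ₜ ℂ := similarity ((1 : ℝ) : ℂ) (Complex.ofReal_ne_zero.mpr one_pos'.ne')
    (-(Complex.exp (α * Complex.I) * ((M + 1 : ℝ) : ℂ))) with hT'
  have hT'ap : ∀ z, T' z = z - Complex.exp (α * Complex.I) * ((M + 1 : ℝ) : ℂ) := fun z => by
    rw [hT', similarity_apply]; push_cast; ring
  have hkey : ∀ z, T' (R (T z)) = R z := fun z => by
    rw [hTap, hRap, hT'ap, hRap]; ring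
  -- the translated domain lies in the right half-plane
  have hD₁ : closure (D.map T).carrier ⊆ {z : ℂ | 0 < z.re} := by
    intro z hz
    rw [MarkedDomain.carrier_map, ← T.image_closure] at hz
    obtain ⟨u, hu, rfl⟩ := hz
    have h1 := hM u hu
    have h2 : |u.re| ≤ ‖u‖ := Complex.abs_re_le_norm u
    have h3 := (abs_le.1 h2).1
    show 0 < (T u).re
    rw [hTap, Complex.add_re, Complex.ofReal_re]
    linarith
  have hrot := rotation_of_closure_subset P hSim hExp (D.map T) hD₁ α
  have hPD₁ : P (D.map T) = (P D).map (CurveClass.map (T : C(ℂ, ℂ))) := hSim D 1 one_pos' _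
  have hcd : P (D.map R) = P (((D.map T).map R).map T') := by
    refine hCD _ _ ?_ ?_ ?_
    · simp only [MarkedDomain.carrier_map, image_image]
      exact image_congr fun z _ => (hkey z).symm
    · simp only [MarkedDomain.pt_map]
      exact (hkey _).symm
    · simp only [MarkedDomain.pt_map]
      exact (hkey _).symm
  have h4 : P (((D.map T).map R).map T') =
      (P ((D.map T).map R)).map (CurveClass.map (T' : C(ℂ, ℂ))) := hSim _ 1 one_pos' _
  rw [hcd, h4, hrot, hPD₁,
    Measure.map_map (measurable_curveClassMap_similarity _ _ _)
      (measurable_curveClassMap_similarity _ _ _),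
    Measure.map_map
      ((measurable_curveClassMap_similarity _ _ _).comp (measurable_curveClassMap_similarity _ _ _))
      (measurable_curveClassMap_similarity _ _ _)]
  congr 1
  funext c
  simp only [Function.comp_apply, curveClass_map_map']
  congr 1
  ext1 z
  simp only [ContinuousMap.comp_apply]
  exact hkey z

/-! ### Step 3: all similarities -/

/-- **Item `RotationsFromExp` (stmt-CriticalPhenomena-6759) of route SAWExpCovariance.** A chordal
family on Dobrushin domains which depends on a domain only through `(carrier, a, b)`, is
covariant under `z ↦ r z + w` (`r > 0`) and is `exp`-covariant on every Dobrushin domain with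
`exp` injective on its closure, is covariant under all orientation-preserving similarities
`z ↦ c z + w`, `c ∈ ℂ*` (`ChordalFamily.IsSimilarityCovariant`): write
`c z + w = ‖c‖ (e^{i arg c} z) + w` and use `rotation_covariance` ("rotations are vertical
translations of the rectangle", Cardy 1984; Beffara 2008 §2). [folklore] -/
theorem rotationsFromExp_proof :
    Summit.CriticalPhenomena.SAWScalingLimit.Theses.SAWExpCovariance.RotationsFromExp := by
  unfold Summit.CriticalPhenomena.SAWScalingLimit.Theses.SAWExpCovariance.RotationsFromExp
  intro P _ hCD hSim hExp D c hc w
  have hr : 0 < ‖c‖ := norm_pos_iff.2 hc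
  set R : ℂ ≃ₜ ℂ := similarity (Complex.exp (Complex.arg c * Complex.I)) (Complex.exp_ne_zero _) 0
    with hR
  have hRap : ∀ z, R z = Complex.exp (Complex.arg c * Complex.I) * z := fun z => by
    rw [hR, similarity_apply, add_zero]
  set S : ℂ ≃ₜ ℂ := similarity ((‖c‖ : ℝ) : ℂ) (Complex.ofReal_ne_zero.mpr hr.ne') w with hS
  have hSap : ∀ z, S z = ((‖c‖ : ℝ) : ℂ) * z + w := fun z => by rw [hS, similarity_apply]
  have hkey : ∀ z, S (R z) = similarity c hc w z := fun z => by
    rw [hSap, hRap, similarity_apply, ← mul_assoc, Complex.norm_mul_exp_arg_mul_I]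
  have hcd : P (D.map (similarity c hc w)) = P ((D.map R).map S) := by
    refine hCD _ _ ?_ ?_ ?_
    · simp only [MarkedDomain.carrier_map, image_image]
      exact image_congr fun z _ => (hkey z).symm
    · simp only [MarkedDomain.pt_map]
      exact (hkey _).symm
    · simp only [MarkedDomain.pt_map]
      exact (hkey _).symm
  have hSc : P ((D.map R).map S) = (P (D.map R)).map (CurveClass.map (S : C(ℂ, ℂ))) :=
    hSim (D.map R) ‖c‖ hr w
  have hRc : P (D.map R) = (P D).map (CurveClass.map (R : C(ℂ, ℂ))) :=
    rotation_covariance P hCD hSim hExp D (Complex.arg c)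
  rw [hcd, hSc, hRc,
    Measure.map_map (measurable_curveClassMap_similarity _ _ _)
      (measurable_curveClassMap_similarity _ _ _)]
  congr 1
  funext γ
  simp only [Function.comp_apply, curveClass_map_map']
  congr 1
  ext1 z
  simp only [ContinuousMap.comp_apply]
  exact hkey z

end Summit.CriticalPhenomena.SAWScalingLimit.Theorems

end
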